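/-
Copyright (c) 2026 the pub-hodgecm-mathlib formalisation cell (harness21).  Prover seat hodgecm-mathlib-K2Liu-p05 (g9), R90-TF section S6 «Ch. 14» (base R90-C14), h413 =
`stmt-HodgeConjecture-24833`; card «FIN», follow-up (R74)(1) of the S6 dealer R90-C14-plan (g3) (R90 bus 2026-09-05T04:03:06Z): the `t_ϖ` letters of the (E1) RECORD head for
the PERMUTED literals `γ₃ = t_ϖ(a,c,b)`-slot and `γ₄ = t_ϖ(b,a,c)`-slot, by instantiation of ★ FIN-2 FILE B (F0P2-p09 (g3)).
-/
import Summits.HodgeConjecture.HodgeConjecture.Theorems.R90S6FlickerLiteralFixFinite   -- ★ p865224 FIN-2 FILE B (F0P2-p09): `flickerFin_finite_fixedBy_quotient_glInt_pi`, `…_conj_glInt_pi`, `flickerFin_finite_range_pow_mk_pi` (the `t_ϖ(x,y,z)` letters)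
import HarnessLib

/-!
# R90-TF · S6 — «FIN» follow-up `R90S6EllipticFixFiniteUniformizer`: the finiteness letters `hfin₀ᵢ hfin₁ᵢ horbᵢ` of the (E1) head for the two PERMUTED `t_ϖ` literals `γ₃`, `γ₄`,
# in the sheet's exact bytes (Flicker 1998 Prop. 3; Kottwitz 1986 §3)

Cell `hodgecm-mathlib`, crux H413 = `stmt-HodgeConjecture-24833`, route of record `HCCMUnconditional`; R90-TF section S6 (base `R90-C14`), dealer R90-C14-plan (g3), hand K2Liu-p05
(g9).  The (E1) RECORD head (typ1 `S6_E1352_elliptic_identity_targets` v2.3 :161ff.) carries, for each of Flicker's four classes `γ₁ = t_1(a,b,c)`, `γ₂ = t_ϖ(a,b,c)`,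
`γ₃` (matrix `!![e(a+b), 0, −e(a−b)ϖ; 0, c, 0; −e(a−b)ϖ⁻¹, 0, e(a+b)]`) and `γ₄` (matrix `!![e(b+c), 0, −e(b−c)ϖ; 0, a, 0; −e(b−c)ϖ⁻¹, 0, e(b+c)]`), the letters `hfin₀ᵢ` (`Fix(U ⧸ K₀)`
finite), `hfin₁ᵢ` (`Fix(U ⧸ K₁)` finite) and `horbᵢ` (the `⟨γᵢ⟩`-orbit of the root coset finite).  ★ FIN part 1 (`R90S6EllipticFixFinite`, p865066) pays them for `γ₁`; ★ FIN-2 FILE B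
(`R90S6FlickerLiteralFixFinite`, p865224) pays them for the GENERIC literal `t_ϖ(x,y,z)` — hence for `γ₂` directly and for `γ₃`, `γ₄` «by permuting `a, b, c`».  THIS FILE spells out
those two permutations so that the (E1) consumer discharges `hfin₀₃ hfin₁₃ horb₃ hfin₀₄ hfin₁₄ horb₄` BY NAME with the sheet's own binders `(ha hb hc hab hbc hac) (γ₃ hγ₃) (γ₄ hγ₄)` and
no argument shuffling: `γ₃ = t_ϖ(x,y,z)` at `(x,y,z) := (a,c,b)` (distinctness letters `hac, hbc.symm, hab`), `γ₄ = t_ϖ(x,y,z)` at `(x,y,z) := (b,a,c)` (`hab.symm, hac, hbc`).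
THEOREMS ONLY (six one-line instantiations; no `def`, no `instance`, no notation, no named-fact hypothesis, no `sorry`; default heartbeats); ★-only import; lane
`--supports stmt-HodgeConjecture-24833 --as helper`.

HONEST LABEL: HC_CM is proved only modulo the 7 printed citations (2 remaining named inputs: hLiu418 = `stmt-HodgeConjecture-24832`, h413 = `stmt-HodgeConjecture-24833`) until
rung 0 closes; finiteness letters are count-neutral plumbing of (E1); nothing here closes a socket; REL ≠ ★ ≠ BUILT.

## References
* [Flicker1998UnitaryFL] Y. Z. Flicker, *Elementary proof of the fundamental lemma for a unitary group*, Canad. J. Math. 50 (1998), §2 Prop. 3 pp. 78–79 (the four classes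
  `t_1(a,b,c)`, `t_ϖ(a,b,c)`, `t_ϖ(a,c,b)`, `t_ϖ(b,a,c)` of the stable class).
* [Kottwitz1986BaseChangeUnits] R. E. Kottwitz, *Base change for unit elements of Hecke algebras*, Compositio Math. 60 (1986), §3 (bounded fixed-point sets of regular elliptic
  elements).
-/

set_option autoImplicit false
-- the mandated namespace repeats the single-problem summit's segment (`HodgeConjecture.HodgeConjecture`)
set_option linter.dupNamespace false

open Matrix
open scoped MatrixGroups WithZero Valued
open Literature.NumberTheory.Automorphic Literature.NumberTheory.Automorphic.HermitianLattice Literature.NumberTheory.Automorphic.UnitaryGroup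

namespace Summit.HodgeConjecture.HodgeConjecture.R90.S6

section PermutedLiterals

variable {K : Type*} [Field K] [Valued K ℤᵐ⁰] [ValuativeRel K] [(Valued.v : Valuation K ℤᵐ⁰).Compatible] {σ : K →+* K} {ϖ : K}

/-! ## §1 `γ₃` — the literal with `c` on the `U(1)`-slot and `(a, b)` in the `ϖ`-twisted corner -/

/-- **`hfin₀₃` — `Fix_{γ₃}(U ⧸ K₀)` is finite** for `γ₃ = !![e(a+b), 0, −e(a−b)ϖ; 0, c, 0; −e(a−b)ϖ⁻¹, 0, e(a+b)]` = ★ `t_ϖ(x,y,z)` at `(x,y,z) := (a,c,b)`.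
[cite: Flicker1998UnitaryFL, §2 Prop. 3 pp. 78–79] [cite: Kottwitz1986BaseChangeUnits, §3] -/
theorem flickerFin_finite_fixedBy_quotient_glInt_pi_acb (hd : UnramifiedLocalConjDatum σ ϖ) [Fintype 𝓀[K]]
    (h2 : Valued.v (2 : K) = 1) {e : K} (h2e : 2 * e = 1)
    {a b c : K} (ha : σ a * a = 1) (hb : σ b * b = 1) (hc : σ c * c = 1) (hab : a ≠ b) (hbc : b ≠ c) (hac : a ≠ c)
    (γ₃ : ↥(unitaryGroupOfForm σ ((StdForm.antidiagonal 3).over K)))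
    (hγ₃ : ((γ₃ : GL (Fin 3) K) : Matrix (Fin 3) (Fin 3) K) = !![e * (a + b), 0, -(e * (a - b) * ϖ); 0, c, 0; -(e * (a - b) * ϖ⁻¹), 0, e * (a + b)]) :
    (MulAction.fixedBy (↥(unitaryGroupOfForm σ ((StdForm.antidiagonal 3).over K)) ⧸
      (glInt 3 K).subgroupOf (unitaryGroupOfForm σ ((StdForm.antidiagonal 3).over K))) γ₃).Finite :=
  flickerFin_finite_fixedBy_quotient_glInt_pi hd h2 h2e ha hc hb hac hbc.symm hab γ₃ hγ₃

/-- **`hfin₁₃` — `Fix_{γ₃}(U ⧸ K₁)` is finite** (`K₁ = g₁GL₃(𝒪)g₁⁻¹ ∩ U`, `g₁ = diag(1,1,ϖ)`). [cite: Flicker1998UnitaryFL, §2 Prop. 3 pp. 78–79] [cite: Kottwitz1986BaseChangeUnits, §3] -/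
theorem flickerFin_finite_fixedBy_quotient_conj_glInt_pi_acb (hd : UnramifiedLocalConjDatum σ ϖ) [Fintype 𝓀[K]]
    (h2 : Valued.v (2 : K) = 1) {e : K} (h2e : 2 * e = 1)
    {a b c : K} (ha : σ a * a = 1) (hb : σ b * b = 1) (hc : σ c * c = 1) (hab : a ≠ b) (hbc : b ≠ c) (hac : a ≠ c)
    (g₁ : GL (Fin 3) K) (hg₁ : (g₁ : Matrix (Fin 3) (Fin 3) K) = Matrix.diagonal ![(1 : K), 1, ϖ])
    (γ₃ : ↥(unitaryGroupOfForm σ ((StdForm.antidiagonal 3).over K)))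
    (hγ₃ : ((γ₃ : GL (Fin 3) K) : Matrix (Fin 3) (Fin 3) K) = !![e * (a + b), 0, -(e * (a - b) * ϖ); 0, c, 0; -(e * (a - b) * ϖ⁻¹), 0, e * (a + b)]) :
    (MulAction.fixedBy (↥(unitaryGroupOfForm σ ((StdForm.antidiagonal 3).over K)) ⧸
      ((glInt 3 K).map (MulAut.conj g₁).toMonoidHom).subgroupOf (unitaryGroupOfForm σ ((StdForm.antidiagonal 3).over K))) γ₃).Finite :=
  flickerFin_finite_fixedBy_quotient_conj_glInt_pi hd h2 h2e ha hc hb hac hbc.symm hab g₁ hg₁ γ₃ hγ₃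

/-- **`horb₃` — the `⟨γ₃⟩`-orbit of the root coset in `U ⧸ K₀` is finite** (no distinctness needed). [cite: Flicker1998UnitaryFL, §2 Prop. 3 p. 79] -/
theorem flickerFin_finite_range_pow_mk_pi_acb (hd : UnramifiedLocalConjDatum σ ϖ) [Fintype 𝓀[K]]
    (h2 : Valued.v (2 : K) = 1) {e : K} (h2e : 2 * e = 1) {a b c : K} (ha : σ a * a = 1) (hb : σ b * b = 1) (hc : σ c * c = 1)
    (γ₃ : ↥(unitaryGroupOfForm σ ((StdForm.antidiagonal 3).over K)))
    (hγ₃ : ((γ₃ : GL (Fin 3) K) : Matrix (Fin 3) (Fin 3) K) = !![e * (a + b), 0, -(e * (a - b) * ϖ); 0, c, 0; -(e * (a - b) * ϖ⁻¹), 0, e * (a + b)]) :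
    (Set.range fun n : ℕ => ((γ₃ ^ n : ↥(unitaryGroupOfForm σ ((StdForm.antidiagonal 3).over K))) :
      ↥(unitaryGroupOfForm σ ((StdForm.antidiagonal 3).over K)) ⧸ (glInt 3 K).subgroupOf (unitaryGroupOfForm σ ((StdForm.antidiagonal 3).over K)))).Finite :=
  flickerFin_finite_range_pow_mk_pi hd h2 h2e ha hc hb γ₃ hγ₃

/-! ## §2 `γ₄` — the literal with `a` on the `U(1)`-slot and `(b, c)` in the `ϖ`-twisted corner -/

/-- **`hfin₀₄` — `Fix_{γ₄}(U ⧸ K₀)` is finite** for `γ₄ = !![e(b+c), 0, −e(b−c)ϖ; 0, a, 0; −e(b−c)ϖ⁻¹, 0, e(b+c)]` = ★ `t_ϖ(x,y,z)` at `(x,y,z) := (b,a,c)`.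
[cite: Flicker1998UnitaryFL, §2 Prop. 3 pp. 78–79] [cite: Kottwitz1986BaseChangeUnits, §3] -/
theorem flickerFin_finite_fixedBy_quotient_glInt_pi_bac (hd : UnramifiedLocalConjDatum σ ϖ) [Fintype 𝓀[K]]
    (h2 : Valued.v (2 : K) = 1) {e : K} (h2e : 2 * e = 1)
    {a b c : K} (ha : σ a * a = 1) (hb : σ b * b = 1) (hc : σ c * c = 1) (hab : a ≠ b) (hbc : b ≠ c) (hac : a ≠ c)
    (γ₄ : ↥(unitaryGroupOfForm σ ((StdForm.antidiagonal 3).over K)))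
    (hγ₄ : ((γ₄ : GL (Fin 3) K) : Matrix (Fin 3) (Fin 3) K) = !![e * (b + c), 0, -(e * (b - c) * ϖ); 0, a, 0; -(e * (b - c) * ϖ⁻¹), 0, e * (b + c)]) :
    (MulAction.fixedBy (↥(unitaryGroupOfForm σ ((StdForm.antidiagonal 3).over K)) ⧸
      (glInt 3 K).subgroupOf (unitaryGroupOfForm σ ((StdForm.antidiagonal 3).over K))) γ₄).Finite :=
  flickerFin_finite_fixedBy_quotient_glInt_pi hd h2 h2e hb ha hc hab.symm hac hbc γ₄ hγ₄

/-- **`hfin₁₄` — `Fix_{γ₄}(U ⧸ K₁)` is finite.** [cite: Flicker1998UnitaryFL, §2 Prop. 3 pp. 78–79] [cite: Kottwitz1986BaseChangeUnits, §3] -/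
theorem flickerFin_finite_fixedBy_quotient_conj_glInt_pi_bac (hd : UnramifiedLocalConjDatum σ ϖ) [Fintype 𝓀[K]]
    (h2 : Valued.v (2 : K) = 1) {e : K} (h2e : 2 * e = 1)
    {a b c : K} (ha : σ a * a = 1) (hb : σ b * b = 1) (hc : σ c * c = 1) (hab : a ≠ b) (hbc : b ≠ c) (hac : a ≠ c)
    (g₁ : GL (Fin 3) K) (hg₁ : (g₁ : Matrix (Fin 3) (Fin 3) K) = Matrix.diagonal ![(1 : K), 1, ϖ])
    (γ₄ : ↥(unitaryGroupOfForm σ ((StdForm.antidiagonal 3).over K)))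
    (hγ₄ : ((γ₄ : GL (Fin 3) K) : Matrix (Fin 3) (Fin 3) K) = !![e * (b + c), 0, -(e * (b - c) * ϖ); 0, a, 0; -(e * (b - c) * ϖ⁻¹), 0, e * (b + c)]) :
    (MulAction.fixedBy (↥(unitaryGroupOfForm σ ((StdForm.antidiagonal 3).over K)) ⧸
      ((glInt 3 K).map (MulAut.conj g₁).toMonoidHom).subgroupOf (unitaryGroupOfForm σ ((StdForm.antidiagonal 3).over K))) γ₄).Finite :=
  flickerFin_finite_fixedBy_quotient_conj_glInt_pi hd h2 h2e hb ha hc hab.symm hac hbc g₁ hg₁ γ₄ hγ₄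

/-- **`horb₄` — the `⟨γ₄⟩`-orbit of the root coset in `U ⧸ K₀` is finite** (no distinctness needed). [cite: Flicker1998UnitaryFL, §2 Prop. 3 p. 79] -/
theorem flickerFin_finite_range_pow_mk_pi_bac (hd : UnramifiedLocalConjDatum σ ϖ) [Fintype 𝓀[K]]
    (h2 : Valued.v (2 : K) = 1) {e : K} (h2e : 2 * e = 1) {a b c : K} (ha : σ a * a = 1) (hb : σ b * b = 1) (hc : σ c * c = 1)
    (γ₄ : ↥(unitaryGroupOfForm σ ((StdForm.antidiagonal 3).over K)))
    (hγ₄ : ((γ₄ : GL (Fin 3) K) : Matrix (Fin 3) (Fin 3) K) = !![e * (b + c), 0, -(e * (b - c) * ϖ); 0, a, 0; -(e * (b - c) * ϖ⁻¹), 0, e * (b + c)]) :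
    (Set.range fun n : ℕ => ((γ₄ ^ n : ↥(unitaryGroupOfForm σ ((StdForm.antidiagonal 3).over K))) :
      ↥(unitaryGroupOfForm σ ((StdForm.antidiagonal 3).over K)) ⧸ (glInt 3 K).subgroupOf (unitaryGroupOfForm σ ((StdForm.antidiagonal 3).over K)))).Finite :=
  flickerFin_finite_range_pow_mk_pi hd h2 h2e hb ha hc γ₄ hγ₄

end PermutedLiterals

end Summit.HodgeConjecture.HodgeConjecture.R90.S6
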